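import Summits.HodgeConjecture.CorCM.Census.CyclicCharacterFibre

/-!
# Cyclic characters, V: THE ARC TYPES `T_a = w⁻¹(a + arc)` — the canonical base block of the class (model for the μ-side)

COR-CM (cell `pub-hodgecm2`), count-neutral kernel combinatorics by the binder seat b09 (gen 41; lane CYCLIC-CHARACTER FIBRE LAW, part VII — the MODEL
the successor needs for the μ-side of the class, cf. `HOME/pub-hodgecm2-b09/lean-g41/METACYCLIC-ROADMAP.md`), on part I (`Census/CyclicCharacterFibre.lean`)
and b09ʼs intrinsic currency (`CMF G c`, `rt`, `blk`: `Census/BlockParityLaw.lean`; `stab`: `Census/HalfParityBlocks.lean`), BY NAME; in the style of the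
twist laneʼs centres (`Census/TwistGenerationModel.cst`).  ONE bookkeeping definition with body (`arcType`) + theorems; no `decide`, no certificate, no named
fact, no `sorry`.  HONEST FRAMING: `HC_CM` is NOT proved, here or anywhere in the tree; nothing here is a period or a headline.

SETTING of part I: `c` a central involution, `w : G → ℤ/2ᵏ` additive (`k ≥ 1`) with `w c ≠ 0` (so `w c = 2ᵏ⁻¹`).  For `a ∈ ℤ/2ᵏ` the **ARC TYPE**
`T_a := {P | (w P − a) mod 2ᵏ < 2ᵏ⁻¹} = w⁻¹(a + arc)`, `arc = {0, …, 2ᵏ⁻¹ − 1}`: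
* §1 `T_a` is a CM type (`arcType`; antipodality `v ∈ arc ↔ v + 2ᵏ⁻¹ ∉ arc`, `lt_half_iff_not_lt_half_add`);
* §2 **base change `T_a·Q⁻¹ = T_{a − w Q}`** (`rt_arcType`), conjugate `T_a·c = T_{a + 2ᵏ⁻¹}`, all arc types lie in ONE block (`blk_arcType_eq`, `w` onto);
* §3 **`a ↦ T_a` is injective** (`arcType_injective`, `w` onto): the arcs of length `2ᵏ⁻¹` in the cycle `ℤ/2ᵏ` are determined by their first point;
* §4 hence **the stabiliser of every arc type is EXACTLY the kernel of `w`** (`mem_stab_arcType_iff`) and **the block of `T_0` is exactly `{T_a : a}`**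
  (`exists_eq_arcType_of_blk_eq`, `blk_eq_iff_exists_eq_arcType`): `2ᵏ` types, the «centres» of the class (for `ℤ/m ⋊ ℤ/8`: the `8` pullbacks of the arcs of
  `ℤ/8`, two sheets `(a, a)`, `(a, a − 1)` in the slot model of the road map).
NUMERICS (road map, `py/arctype.py`): with `T_0` as base type, gen 38ʼs cover (one descending face per block of `bpot ≥ 2`) plus `2ᵏ⁻¹ − 1 + d` closing faces at
the types of `bpot ≤ 1` generate `hodgeSpan` INTEGRALLY with EXACTLY `φ₂ = β − 2 + d` faces in every row computed — `Dic₃`, `ℤ/12`, `Dic₅`, `ℤ/4⋊ℤ/4` (both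
central `c`), `Q₈ ×_ε ℤ/4`, `ℤ/24`, and the first metacyclic row beyond seat b23ʼs dicyclic law: **`μ(ℤ/3 ⋊ ℤ/8) = 171 = φ₂`** (167 + 4 faces, index 1).

## References
* [Pohlmann1968] H. Pohlmann, Algebraic cycles on abelian varieties of complex multiplication type, Ann. of Math. 88 (1968), Thm 1.
* [Milne1999] J. S. Milne, Lefschetz motives and the Tate conjecture, Compositio Math. 117 (1999), Prop. 2.1, p. 54.
-/

namespace Summit.HodgeConjecture.CorCM.Census.CyclicCharacter

open Finset
open Summit.HodgeConjecture.CorCM.Prior.AllgGroup.RfwfAllgGroup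
open Summit.HodgeConjecture.CorCM.Census.BlockParity
open Summit.HodgeConjecture.CorCM.Census.HalfParity

noncomputable section

variable {G : Type*} [Group G] [Fintype G] [DecidableEq G] {k : ℕ} {w : G → ZMod (2 ^ k)} {c : G}

/-! ## §1 Antipodality in `ℤ/2ᵏ` and the arc types -/

omit [Fintype G] [DecidableEq G] in
/-- `val (v + 2ᵏ⁻¹)` in `ℤ/2ᵏ` (`k ≥ 1`). [folklore] -/
theorem val_add_half (hk : 1 ≤ k) (v : ZMod (2 ^ k)) :
    (v + ((2 ^ (k - 1) : ℕ) : ZMod (2 ^ k))).val = if v.val < 2 ^ (k - 1) then v.val + 2 ^ (k - 1) else v.val - 2 ^ (k - 1) := by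
  haveI : NeZero (2 ^ k) := ⟨pow_ne_zero _ two_ne_zero⟩
  have h2k : 2 ^ k = 2 * 2 ^ (k - 1) := by rw [← pow_succ', Nat.sub_add_cancel hk]
  rw [ZMod.val_add, val_two_pow_pred hk]
  have hv := ZMod.val_lt v
  split_ifs with h
  · exact Nat.mod_eq_of_lt (by omega)
  · rw [Nat.mod_eq_sub_mod (by omega), Nat.mod_eq_of_lt (by omega)]
    omega

omit [Fintype G] [DecidableEq G] in
/-- **Antipodality**: exactly one of `v`, `v + 2ᵏ⁻¹` lies in the arc `[0, 2ᵏ⁻¹)` (`k ≥ 1`). [folklore] -/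
theorem lt_half_iff_not_lt_half_add (hk : 1 ≤ k) (v : ZMod (2 ^ k)) :
    v.val < 2 ^ (k - 1) ↔ ¬ (v + ((2 ^ (k - 1) : ℕ) : ZMod (2 ^ k))).val < 2 ^ (k - 1) := by
  haveI : NeZero (2 ^ k) := ⟨pow_ne_zero _ two_ne_zero⟩
  have h2k : 2 ^ k = 2 * 2 ^ (k - 1) := by rw [← pow_succ', Nat.sub_add_cancel hk]
  rw [val_add_half hk]
  have hv := ZMod.val_lt v
  split_ifs with h <;> omega

/-- **THE ARC TYPE `T_a = w⁻¹(a + arc) = {P | (w P − a) mod 2ᵏ < 2ᵏ⁻¹}`** of a cyclic character `w` non-zero on the central involution `c`. [folklore] -/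
def arcType (hw : ∀ P Q : G, w (P * Q) = w P + w Q) (hk : 1 ≤ k) (hc2 : c * c = 1) (hwc : w c ≠ 0) (a : ZMod (2 ^ k)) : CMF G c :=
  ⟨univ.filter fun P => (w P - a).val < 2 ^ (k - 1), by
    intro x
    simp only [mem_filter, mem_univ, true_and, hw, apply_c hw hk hc2 hwc]
    rw [show ((2 ^ (k - 1) : ℕ) : ZMod (2 ^ k)) + w x - a = (w x - a) + ((2 ^ (k - 1) : ℕ) : ZMod (2 ^ k)) by abel]
    exact lt_half_iff_not_lt_half_add hk _⟩

/-- Membership in an arc type. [folklore] -/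
@[simp] theorem mem_arcType (hw : ∀ P Q : G, w (P * Q) = w P + w Q) (hk : 1 ≤ k) (hc2 : c * c = 1) (hwc : w c ≠ 0) (a : ZMod (2 ^ k)) (P : G) :
    P ∈ (arcType hw hk hc2 hwc a).1 ↔ (w P - a).val < 2 ^ (k - 1) := by
  simp [arcType]

/-! ## §2 Base change of arc types -/

/-- **Base change of an arc type is an arc type: `T_a·Q⁻¹ = T_{a − w Q}`.** [folklore] -/
theorem rt_arcType (hw : ∀ P Q : G, w (P * Q) = w P + w Q) (hk : 1 ≤ k) (hc2 : c * c = 1) (hwc : w c ≠ 0) (Q : G) (a : ZMod (2 ^ k)) :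
    rt c Q (arcType hw hk hc2 hwc a) = arcType hw hk hc2 hwc (a - w Q) := by
  apply Subtype.ext; ext P
  rw [mem_rt, mem_arcType, mem_arcType, hw, show w P + w Q - a = w P - (a - w Q) by abel]

/-- **The conjugate of an arc type: `T_a·c = T_{a + 2ᵏ⁻¹}`.** [folklore] -/
theorem rt_self_arcType (hw : ∀ P Q : G, w (P * Q) = w P + w Q) (hk : 1 ≤ k) (hc2 : c * c = 1) (hwc : w c ≠ 0) (a : ZMod (2 ^ k)) :
    rt c c (arcType hw hk hc2 hwc a) = arcType hw hk hc2 hwc (a + ((2 ^ (k - 1) : ℕ) : ZMod (2 ^ k))) := by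
  rw [rt_arcType, apply_c hw hk hc2 hwc]
  congr 1
  have h2k : 2 ^ k = 2 * 2 ^ (k - 1) := by rw [← pow_succ', Nat.sub_add_cancel hk]
  rw [sub_eq_iff_eq_add, add_assoc, ← Nat.cast_add, ← two_mul, ← h2k, ZMod.natCast_self, add_zero]

omit [Fintype G] [DecidableEq G] in
/-- Every value is attained by an onto character: `∃ g, w g = t` (from `w g₁ = 1`). [folklore] -/
theorem exists_apply_eq (hw : ∀ P Q : G, w (P * Q) = w P + w Q) (h1 : ∃ g₁ : G, w g₁ = 1) (t : ZMod (2 ^ k)) : ∃ g : G, w g = t := by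
  haveI : NeZero (2 ^ k) := ⟨pow_ne_zero _ two_ne_zero⟩
  obtain ⟨g₁, hg₁⟩ := h1
  exact ⟨g₁ ^ t.val, by rw [map_pow hw, hg₁, nsmul_eq_mul, mul_one, ZMod.natCast_zmod_val]⟩

/-- **Arc types are base changes of one another**: `T_a = T_0·Q⁻¹` for any `Q` with `w Q = −a`. [folklore] -/
theorem arcType_eq_rt (hw : ∀ P Q : G, w (P * Q) = w P + w Q) (hk : 1 ≤ k) (hc2 : c * c = 1) (hwc : w c ≠ 0) {Q : G} {a : ZMod (2 ^ k)}
    (hQ : w Q = -a) : arcType hw hk hc2 hwc a = rt c Q (arcType hw hk hc2 hwc 0) := by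
  rw [rt_arcType, hQ, zero_sub, neg_neg]

/-- **All arc types lie in one block** (`w` onto). [folklore] -/
theorem blk_arcType_eq (hw : ∀ P Q : G, w (P * Q) = w P + w Q) (hk : 1 ≤ k) (hc2 : c * c = 1) (hwc : w c ≠ 0) (h1 : ∃ g₁ : G, w g₁ = 1)
    (a : ZMod (2 ^ k)) : blk c (arcType hw hk hc2 hwc a) = blk c (arcType hw hk hc2 hwc 0) := by
  obtain ⟨Q, hQ⟩ := exists_apply_eq hw h1 (-a)
  rw [arcType_eq_rt hw hk hc2 hwc hQ, blk_rt]

/-! ## §3 `a ↦ T_a` is injective -/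

omit [Fintype G] [DecidableEq G] in
/-- For `δ ≠ 0` in `ℤ/2ᵏ` (`k ≥ 1`) some point of the arc leaves the arc under translation by `δ`. [folklore] -/
theorem exists_lt_half_and_not (hk : 1 ≤ k) {δ : ZMod (2 ^ k)} (hδ : δ ≠ 0) :
    ∃ s : ZMod (2 ^ k), s.val < 2 ^ (k - 1) ∧ ¬ (s + δ).val < 2 ^ (k - 1) := by
  haveI : NeZero (2 ^ k) := ⟨pow_ne_zero _ two_ne_zero⟩
  have h2k : 2 ^ k = 2 * 2 ^ (k - 1) := by rw [← pow_succ', Nat.sub_add_cancel hk]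
  have hδ0 : δ.val ≠ 0 := fun h => hδ ((ZMod.val_eq_zero δ).mp h)
  have hδlt := ZMod.val_lt δ
  by_cases hle : δ.val ≤ 2 ^ (k - 1)
  · -- the last point of the arc
    refine ⟨((2 ^ (k - 1) - 1 : ℕ) : ZMod (2 ^ k)), ?_, ?_⟩
    · rw [ZMod.val_natCast, Nat.mod_eq_of_lt (by omega)]
      have := Nat.one_le_two_pow (n := k - 1)
      omega
    · rw [ZMod.val_add, ZMod.val_natCast, Nat.mod_eq_of_lt (show 2 ^ (k - 1) - 1 < 2 ^ k by omega), Nat.mod_eq_of_lt (by omega)]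
      have := Nat.one_le_two_pow (n := k - 1)
      omega
  · -- the first point of the arc
    refine ⟨0, ?_, ?_⟩
    · rw [ZMod.val_zero]; exact Nat.one_le_two_pow
    · rw [zero_add]; omega

/-- **`a ↦ T_a` is injective** (`w` onto, `k ≥ 1`). [folklore] -/
theorem arcType_injective (hw : ∀ P Q : G, w (P * Q) = w P + w Q) (hk : 1 ≤ k) (hc2 : c * c = 1) (hwc : w c ≠ 0) (h1 : ∃ g₁ : G, w g₁ = 1) :
    Function.Injective (arcType hw hk hc2 hwc) := by
  intro a b hab
  by_contra hne
  obtain ⟨s, hs, hsδ⟩ := exists_lt_half_and_not hk (sub_ne_zero.mpr (Ne.symm hne))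
  -- a point `g` with `w g − b = s` lies in `T_b` but not in `T_a`
  obtain ⟨g, hg⟩ := exists_apply_eq hw h1 (s + b)
  have hgb : g ∈ (arcType hw hk hc2 hwc b).1 := by rw [mem_arcType, hg, add_sub_cancel_right]; exact hs
  have hga : g ∉ (arcType hw hk hc2 hwc a).1 := by
    rw [mem_arcType, hg, show s + b - a = s + (b - a) by abel]; exact hsδ
  rw [hab] at hga
  exact hga hgb

/-! ## §4 The stabiliser and the block of the arc types -/

/-- **`T_a·Q⁻¹ = T_a ↔ w Q = 0`.** [folklore] -/
theorem rt_arcType_eq_self_iff (hw : ∀ P Q : G, w (P * Q) = w P + w Q) (hk : 1 ≤ k) (hc2 : c * c = 1) (hwc : w c ≠ 0) (h1 : ∃ g₁ : G, w g₁ = 1)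
    (Q : G) (a : ZMod (2 ^ k)) : rt c Q (arcType hw hk hc2 hwc a) = arcType hw hk hc2 hwc a ↔ w Q = 0 := by
  rw [rt_arcType, (arcType_injective hw hk hc2 hwc h1).eq_iff, sub_eq_self]

/-- **The stabiliser of every arc type is EXACTLY the kernel of `w`** (`w` onto). [folklore] -/
theorem mem_stab_arcType_iff (hw : ∀ P Q : G, w (P * Q) = w P + w Q) (hk : 1 ≤ k) (hc2 : c * c = 1) (hwc : w c ≠ 0) (h1 : ∃ g₁ : G, w g₁ = 1)
    (Q : G) (a : ZMod (2 ^ k)) : Q ∈ stab c (arcType hw hk hc2 hwc a) ↔ w Q = 0 := by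
  rw [mem_stab, rt_arcType_eq_self_iff hw hk hc2 hwc h1]

/-- **The block of `T_0` consists of arc types**: `blk Ψ = blk T_0 ⇒ Ψ = T_a` for some `a`. [folklore] -/
theorem exists_eq_arcType_of_blk_eq (hw : ∀ P Q : G, w (P * Q) = w P + w Q) (hk : 1 ≤ k) (hc2 : c * c = 1) (hwc : w c ≠ 0) {Ψ : CMF G c}
    (hΨ : blk c Ψ = blk c (arcType hw hk hc2 hwc 0)) : ∃ a : ZMod (2 ^ k), Ψ = arcType hw hk hc2 hwc a := by
  obtain ⟨Q, hQ⟩ := exists_rt_eq_of_blk_eq c hΨ.symm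
  exact ⟨0 - w Q, by rw [← hQ, rt_arcType]⟩

/-- **The block of `T_0` is EXACTLY the set of arc types** (`w` onto): `blk Ψ = blk T_0 ↔ ∃ a, Ψ = T_a`. [folklore] -/
theorem blk_eq_iff_exists_eq_arcType (hw : ∀ P Q : G, w (P * Q) = w P + w Q) (hk : 1 ≤ k) (hc2 : c * c = 1) (hwc : w c ≠ 0)
    (h1 : ∃ g₁ : G, w g₁ = 1) (Ψ : CMF G c) :
    blk c Ψ = blk c (arcType hw hk hc2 hwc 0) ↔ ∃ a : ZMod (2 ^ k), Ψ = arcType hw hk hc2 hwc a := by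
  constructor
  · exact exists_eq_arcType_of_blk_eq hw hk hc2 hwc
  · rintro ⟨a, rfl⟩
    exact blk_arcType_eq hw hk hc2 hwc h1 a

/-- **The arc block has exactly `2ᵏ` members**: `a ↦ T_a` is a bijection from `ℤ/2ᵏ` onto the block of `T_0` (`w` onto). [folklore] -/
theorem card_filter_blk_eq_arcType (hw : ∀ P Q : G, w (P * Q) = w P + w Q) (hk : 1 ≤ k) (hc2 : c * c = 1) (hwc : w c ≠ 0)
    (h1 : ∃ g₁ : G, w g₁ = 1) [Fintype (CMF G c)] :
    ((univ : Finset (CMF G c)).filter fun Ψ => blk c Ψ = blk c (arcType hw hk hc2 hwc 0)).card = 2 ^ k := by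
  classical
  haveI : NeZero (2 ^ k) := ⟨pow_ne_zero _ two_ne_zero⟩
  have himg : ((univ : Finset (CMF G c)).filter fun Ψ => blk c Ψ = blk c (arcType hw hk hc2 hwc 0)) =
      (univ : Finset (ZMod (2 ^ k))).image (arcType hw hk hc2 hwc) := by
    ext Ψ
    rw [mem_filter, mem_image, blk_eq_iff_exists_eq_arcType hw hk hc2 hwc h1]
    simp only [mem_univ, true_and, eq_comm]
  rw [himg, card_image_of_injective _ (arcType_injective hw hk hc2 hwc h1), card_univ, ZMod.card]

end

end Summit.HodgeConjecture.CorCM.Census.CyclicCharacter
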